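import Mathlib
import Summits.ValiantsHypothesis.ValiantsHypothesis.Theorems.SymPencilSymmetrizePermPairsStubInduceWiring
import Summits.ValiantsHypothesis.ValiantsHypothesis.Theorems.SymPencilSymmetrizePermPairsInducedSumPencil
import HarnessLib

/-!
# ValiantsHypothesis / SymPencil — crux `SymmetrizePermPairs` (stmt-ValiantsHypothesis-17793),
# stub `stub_induce`: the CLOSER (merged-desk RULING #213)

`stub_induce` = the registered signature of `Cruxes/SdcThesis/Lines/birth_SymmetrizePermPairs.lean`
VERBATIM (with the line file's `abbrev permPairSubst n` spelled out), proved as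
`stub_induce_of_C3 C3_holds` where `C3_holds` is the (C3) binder discharged by p7's induced-sum
pencil `exists_isSymm_isEquivariantDetRepr_of_covariant_family` (`…InducedSumPencil.lean`: Le Verrier
DAG of the covariant block family + GKKP DAG pencil + currency bridge + rescaling) through the
adapter of this file: permutation-CONGRUENCE covariance `P_σ B P_σᵀ` ↔ `submatrix σ σ`
(p7's `Dag.permMatrix_mul_mul_transpose_eq_submatrix`), the degenerate size `m′ = 0` (a `0 × 0` pencil is equivariant for free),
and the size arithmetic `2R(m′³+m′)+3 ≤ (R m′ + 2)^4` (`dag_size_le`).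

Honest framing: this closes the STUB `stub_induce` of the line; the crux `SymmetrizePermPairs` still
rests on `stub_stabIndex` (the rigidity half, XL, untouched) and stays OPEN; `VP ≠ VNP` is NOT proved
and nothing here is progress on it.  No new definitions, no named facts.
-/

noncomputable section

-- `Summit.ValiantsHypothesis.ValiantsHypothesis.…` is the tree's mandated single-conjunct layout
-- (Sub = Summit), so the duplicated namespace component is intended.
set_option linter.dupNamespace false

namespace Summit.ValiantsHypothesis.ValiantsHypothesis.Theorems.SymPencilEquivariantSdcNotQP

open Literature.Computability.AlgebraicComplexity MvPolynomial Matrix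
open Summit.ValiantsHypothesis.ValiantsHypothesis.Theorems.SymPencilSymmetrizePermPairs

/-! ### Size bookkeeping -/

/-- `2R(m³ + m) + 3 ≤ (R m + 2)^4` for `R, m ≥ 1`. [folklore] -/
theorem dag_size_le (R m : ℕ) (hR : 1 ≤ R) (hm : 1 ≤ m) :
    2 * R * (m ^ 3 + m) + 3 ≤ (R * m + 2) ^ 4 := by
  set x := R * m with hx
  have hx1 : 1 ≤ x := by
    rw [hx]; exact Nat.one_le_iff_ne_zero.mpr (Nat.mul_ne_zero (by omega) (by omega))
  have h1 : R * m ^ 3 ≤ x ^ 3 := by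
    rw [hx, mul_pow]
    exact Nat.mul_le_mul_right _ (Nat.le_self_pow (by norm_num) R)
  have h4 : x ^ 3 ≤ (x + 2) ^ 3 := Nat.pow_le_pow_left (by omega) 3
  have h3 : x + 2 ≤ (x + 2) ^ 3 := by nlinarith
  calc 2 * R * (m ^ 3 + m) + 3 = 2 * (R * m ^ 3) + (2 * (R * m) + 3) := by ring
    _ ≤ 2 * (x + 2) ^ 3 + (x + 2) ^ 3 := by nlinarith
    _ = 3 * (x + 2) ^ 3 := by ring
    _ ≤ (x + 2) * (x + 2) ^ 3 := Nat.mul_le_mul_right _ (by omega)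
    _ = (x + 2) ^ 4 := by ring

/-! ### A `0 × 0` pencil is equivariant for free -/

/-- Every `0 × 0` affine determinantal representation is `Γ`-equivariant (all `0 × 0` matrices
coincide). [folklore] -/
theorem isEquivariantDetRepr_fin_zero {n : ℕ} (Γ : Subgroup (GL (Fin n × Fin n) ℂ))
    (f : MvPolynomial (Fin n × Fin n) ℂ) (A : Matrix (Fin 0) (Fin 0) (MvPolynomial (Fin n × Fin n) ℂ))
    (hA : IsAffineDetRepr f A) : IsEquivariantDetRepr Γ f A := by
  refine ⟨hA, fun γ _ => ⟨1, 1, ?_⟩⟩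
  ext i
  exact Fin.elim0 i

/-! ### (C3) holds -/

/-- **(C3) holds** — the hypothesis of `stub_induce_of_C3`, TOKEN-FOR-TOKEN: a covariant family of
`R ≥ 1` affine pencils of size `m′` with determinant `per_n` yields a symmetric `Γ_n`-equivariant
affine determinantal representation of `per_n` of size `≤ (R m′ + 2)^4`.  For `m′ ≥ 1` this is p7's
`Dag.exists_isSymm_isEquivariantDetRepr_of_covariant_family` (Le Verrier DAG + GKKP DAG pencil +
currency bridge + rescaling; size `2R(m′³+m′)+3 ≤ (R m′ + 2)^4`, `dag_size_le`) after converting the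
permutation-congruence covariance to `submatrix` form (`Dag.permMatrix_mul_mul_transpose_eq_submatrix`);
for `m′ = 0` the block `B₀` itself (a `0 × 0` pencil) is symmetric and equivariant. [folklore] -/
theorem C3_holds :
    ∃ e : ℕ, ∀ (n R m' : ℕ)
      (B : Fin R → Matrix (Fin m') (Fin m') (MvPolynomial (Fin n × Fin n) ℂ)),
      (∀ i, IsAffineDetRepr (perPoly (Fin n) ℂ) (B i)) →
      (∀ π ρ : Equiv.Perm (Fin n), ∃ (τ : Equiv.Perm (Fin R)) (P : Fin R → Equiv.Perm (Fin m')),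
        ∀ i, (B i).map (MvPolynomial.rename fun ij : Fin n × Fin n => (π ij.1, ρ ij.2)) =
          ((P i).permMatrix ℂ).map MvPolynomial.C * B (τ i) *
            (((P i).permMatrix ℂ)ᵀ).map MvPolynomial.C) →
      1 ≤ R →
      ∃ m'' ≤ (R * m' + 2) ^ e, ∃ A'' : Matrix (Fin m'') (Fin m'') (MvPolynomial (Fin n × Fin n) ℂ),
        A''.IsSymm ∧ IsEquivariantDetRepr (Subgroup.closure {γ : GL (Fin n × Fin n) ℂ |
          ∃ π ρ : Equiv.Perm (Fin n), (γ : Matrix (Fin n × Fin n) (Fin n × Fin n) ℂ) =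
            Equiv.Perm.permMatrix ℂ (Equiv.prodCongr π ρ)}) (perPoly (Fin n) ℂ) A'' := by
  classical
  refine ⟨4, fun n R m' B hBaff hBcov hR => ?_⟩
  rcases Nat.eq_zero_or_pos m' with hm0 | hm
  · -- `m′ = 0`: the `0 × 0` block itself
    subst hm0
    refine ⟨0, Nat.zero_le _, B ⟨0, hR⟩, ?_, isEquivariantDetRepr_fin_zero _ _ _ (hBaff ⟨0, hR⟩)⟩
    exact Matrix.ext fun i => Fin.elim0 i
  · -- `m′ ≥ 1`: p7's induced-sum pencil
    have hcov' : ∀ π ρ : Equiv.Perm (Fin n), ∃ (τ : Equiv.Perm (Fin R))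
        (P : Fin R → Equiv.Perm (Fin m')), ∀ i,
        (B i).map (MvPolynomial.rename fun jk : Fin n × Fin n => (π jk.1, ρ jk.2)) =
          (B (τ i)).submatrix (P i) (P i) := by
      intro π ρ
      obtain ⟨τ, P, h⟩ := hBcov π ρ
      exact ⟨τ, P, fun i => by rw [h i, Dag.permMatrix_mul_mul_transpose_eq_submatrix]⟩
    obtain ⟨m'', hm'', A, hAsymm, hA⟩ :=
      Dag.exists_isSymm_isEquivariantDetRepr_of_covariant_family n R m' hR hm (perPoly (Fin n) ℂ)
        B hBaff hcov'
    exact ⟨m'', hm''.trans (dag_size_le R m' hR hm), A, hAsymm, hA⟩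

/-! ### The closer -/

/-- **`stub_induce`** — the registered stub of `Cruxes/SdcThesis/Lines/birth_SymmetrizePermPairs.lean`,
signature VERBATIM (the line file's `abbrev permPairSubst n` spelled out): equivariance of a symmetric
affine pencil of `per_n` for a subgroup `Γ' ≤ Γ_n` of relative index `R` induces a symmetric
`Γ_n`-EQUIVARIANT affine pencil of `per_n` at quasi-polynomial cost in `m R + m`.
Proof: `stub_induce_of_C3 C3_holds` — the permify_subgroup branch ([R1]–[R4], (G1)–(G5), (K4), p7's
symmetric core + spin dichotomy, [A1′]–[A5], [A4]), the induced blocks ((I1′), p4), and the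
equivariant GKKP in the DAG model ([Q1]–[Q3], p7; currency, p4).  The crux `SymmetrizePermPairs` still
rests on `stub_stabIndex` (OPEN); `VP ≠ VNP` is NOT proved. [folklore] -/
theorem stub_induce :
    ∃ d : ℕ, ∀ (n m : ℕ) (A : Matrix (Fin m) (Fin m) (MvPolynomial (Fin n × Fin n) ℂ))
      (Γ' : Subgroup (GL (Fin n × Fin n) ℂ)),
      Γ' ≤ Subgroup.closure {γ : GL (Fin n × Fin n) ℂ | ∃ π ρ : Equiv.Perm (Fin n),
        (γ : Matrix (Fin n × Fin n) (Fin n × Fin n) ℂ) = Equiv.Perm.permMatrix ℂ (Equiv.prodCongr π ρ)} →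
      A.IsSymm →
      IsEquivariantDetRepr Γ' (perPoly (Fin n) ℂ) A →
      ∃ m' ≤ 2 ^ ((Nat.log 2 (m * Γ'.relIndex (Subgroup.closure {γ : GL (Fin n × Fin n) ℂ |
          ∃ π ρ : Equiv.Perm (Fin n), (γ : Matrix (Fin n × Fin n) (Fin n × Fin n) ℂ) =
            Equiv.Perm.permMatrix ℂ (Equiv.prodCongr π ρ)}) + m) + d) ^ d),
        ∃ A' : Matrix (Fin m') (Fin m') (MvPolynomial (Fin n × Fin n) ℂ),
          A'.IsSymm ∧ IsEquivariantDetRepr (Subgroup.closure {γ : GL (Fin n × Fin n) ℂ |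
            ∃ π ρ : Equiv.Perm (Fin n), (γ : Matrix (Fin n × Fin n) (Fin n × Fin n) ℂ) =
              Equiv.Perm.permMatrix ℂ (Equiv.prodCongr π ρ)}) (perPoly (Fin n) ℂ) A' :=
  stub_induce_of_C3 C3_holds

end Summit.ValiantsHypothesis.ValiantsHypothesis.Theorems.SymPencilEquivariantSdcNotQP

end
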